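import Summits.QuantumFields.YangMills.Theorems.BalabanUVNodesN11ReadRegRePinned
import Summits.QuantumFields.YangMills.Theorems.BalabanUVNodesN11ChargedSepJunctionOfSolvableFibre
import Summits.QuantumFields.YangMills.Theorems.BalabanUVNodesN11GaussianCertificateRows

/-!
# DAG node N11 — ★★★★★ THE NO-EXPANSION 𝐓-STEP IN THE «ZhPin CLASS» (any v1.7 parameter whose history-indexed residual has this seat's certificate `ζ0`: `rePinH θ`,
# dag-n11-w1's `gaussPinH θ`) FROM K0's ROWS (per-cube [15]-solvability + cube cover + numerics at every level `1 ≤ j ≤ k`) AND THE STRUCTURAL ROWS ALONE —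
# `ZhUnity`, 12a″'s `RegOn` AND the (7)-data row `h7` ALL DISCHARGED (conclusions VERBATIM p598649)

HEADER — WORK-UNIT METADATA.  Cell `pub-ymgap`, YM-PLAN Track A (HUMAN RULING D-0062), seat `pub-ymgap-dag-n11-d` (g13; R134 fan-out seat N11 [B14], strategy s2),
route `BalabanUVNodes`, item K1⁷ `StabilityBAtRecordR13SepCoPH` = stmt-QuantumFields-20542 (helper, `--kind proof --supports 20542 --as helper`, count-neutral).
[III] = [Balaban1988Convergent], [15] = [Balaban1985Variational], [B7] = [Balaban1985Averaging], [6] = [Balaban1985RegularSpaces].  Over g13's `…N11ChargedSepJunctionFibre` (the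
faces with the junction on the iterated fibre, any selector), `…N11ChargedSepJunctionOfSolvableFibre` (★★★ `sepJunctionChargedFibre_of_solvable` — NO (7)-data row),
`…N11ReadRegRePinned` (★★★ `regOn_rePinH_cutSel_of_solvable`), g9's `…N11HistoryPinnedResidualDefs` (`ZhPinOfRecord₁₃`) ∕ `…N11RePinnedParamDefs` (`rePinH`), dag-n11-w1's
`…N11GaussianCertificateRows` (`zhUnity_of_gaussCert` — the class's `ZhUnity`, whose hypothesis shape `hζ0` this file adopts).

WHY THIS FILE (the g13 endpoint).  The general-history no-expansion 𝐓-step of N11's (S1ᵀ) conjunct had, after g12, the displayed rows: K0's `Provisos₁₃SepCoPH`, `ZhUnity`,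
`Admissible`, `s2.Pos`, `0 < M₁ ≤ M`, window, `PartCompat₁₃`, 12a″ `RegOn (readSelOfSeq)`, the junction [`2 ≤ cR` + per-cube [15]-solvability + cube cover + numerics + the
(7)-DATA ROW `h7`], and `SLaw`∕`hBt`.  g13's iterated-fibre chain removes `h7` (the mixed (7) field is the datum on the fibre, by separation); and for every parameter of the
ZhPin class — history-indexed residual `ζ0` = this seat's certificate (`hζ0`, the shape of dag-n11-w1's `gaussPinH_ζ0`; the Gaussian `quad` is free) — `RegOn` holds on the cut
selector from [15]-solvability (`…N11ReadRegRePinned`, transported along `hζ0`) and `ZhUnity` holds outright.  What remains is exactly K0's analysis (`Provisos₁₃SepCoPH θ`, per-cube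
[15]-solvability inside `χ_j` and the cube cover at every level `1 ≤ j ≤ k`), the run's window ∕ `PartCompat₁₃` ∕ numerics (`2 ≤ cR`, `ε_j` in [B7] Prop. 2's range, cube side vs
boxes, `1 ≤ k ≤ m + K`, `0 < M₁ ≤ M`, `1 ≤ M`), and the §2 input (`SLaw₁₃CoPH F N θ p k`, or a named witness with Borel 𝐁-terms) — for dag-n11-w1's
`…Sect3SupplyChainBorelBObligations` at `gaussPinH θ`: instantiate `hζ0 := gaussPinH_ζ0 θ`.

WHAT THIS FILE PROVES (0 `sorry`, 0 `def`).  §1 ★★★ `regOn_cutSel_of_zhPin_of_solvable` (`ZhUnity` in the class is dag-n11-w1's `zhUnity_of_gaussCert`, imported).  §2 ★★★★★ `exists_local_witness_clause_succ_of_sLaw₁₃CoPH_of_zhPin_of_solvable`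
and ★★★★★ `exists_local_witness_clause_succ_of_hasSect2FormAtZS_of_borelB_of_zhPin_of_solvable` — p598649's two faces in the ZhPin class, conclusions VERBATIM, hypotheses = the rows just
listed (`hreg` := §1 on the cut selector, `hJ` := `sepJunctionChargedFibre_of_solvable` read through `sep_setOf_eq_of`, `hU` := `zhUnity_of_gaussCert`).  §3 `rePinH_zhPin` (`rfl`).

HONEST FRAMING.  Helper lane of K1⁷; composition; nothing of [III] ∕ [15] ∕ [B7] asserted (solvability, cover, numerics, `Provisos₁₃SepCoPH` are HYPOTHESES — K0 ∕ def-R ∕ plan rows;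
K0a's `cR := 1`, `M = M₂ = 1` meet NEITHER `2 ≤ cR` NOR the cover, located g12).  The binders INSIDE the conclusion ((P) prefix agreement, (V) pin, `quad` rows, measurability,
A-fibre domination, 𝐁 joint measurability) are untouched — at `rePinH θ` (P)∕(V)∕`quad` are g9's faces, A-fibre domination there holds on the all-small branches only (`quad ≡ 0`;
dag-n11-w1 ∕ -w4: Gaussian certificate + coercivity).  N11 NOT discharged; K1⁷ NOT closed; counts unmoved (typed 28∕28 · discharged 5∕27).  One finite four-torus programme at fixed
`ε = L^{−K}` — NOT ℝ⁴, NOT OS, NOT a mass gap, NOT Clay.  No `sorry`, `axiom`, `def`, `instance`, `notation`.  Sources (SHAPE only): [III] Theorem p.245, (2.1)–(2.2) pp.254–255,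
(2.7) p.255, (2.10) p.256, (2.16)–(2.18) p.257, (2.20)–(2.28) pp.258–259, (3.5) p.265, (3.16)–(3.20) pp.268–269, (3.24)–(3.25) p.270; [15] Thm 1 (7)–(8) pp.278–279; [B7] Prop. 2 p.26;
[6] (1.3)–(1.6) p.77.
-/

noncomputable section

open MeasureTheory
open scoped BigOperators ENNReal NNReal Matrix.Norms.L2Operator

namespace Summit.QuantumFields.YangMills.Theorems.BalabanUVNodesN11NoExpansionTStepZhPinOfSolvable

open Literature.MathematicalPhysics.QuantumFieldTheory.Balaban1983to89 T4Continuum T4NestedCovariance Node00 Node00.Tk DagBinding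
open B15DeterminingSets B8Eq17ClassAkV1 B14.Eq218Concrete B10Eq42TorusConstraint
open B14.Eq213MaximalDomains (side)
open B14.Eq213DetSet (Bj)
open Literature.MathematicalPhysics.QuantumFieldTheory.BalabanImbrieJaffe1984to88.BIJ85Eq453GaugeField (qsstarGIter0)
open BalabanUVNodesN11FluctTruncationDefs (IsFluctLocal)
open BalabanUVNodesN11SpaceTruncationDefs BalabanUVNodesN11SpaceTruncationBorelBDefs
open BalabanUVNodesN11HistoryPinnedResidualDefs BalabanUVNodesN11RePinnedParamDefs
open BalabanUVNodesN11ChargedSepJunctionFibre (exists_local_witness_clause_succ_of_sLaw₁₃CoPH_of_sep_of_junctionFibre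
  exists_local_witness_clause_succ_of_hasSect2FormAtZS_of_borelB_of_sep_of_junctionFibre)
open BalabanUVNodesN11ChargedSepJunctionOfSolvableFibre (sepJunctionChargedFibre_of_solvable)
open BalabanUVNodesN11ReadRegRePinned (regOn_rePinH_cutSel_of_solvable sep_setOf_eq_of)
open BalabanUVNodesN11GaussianCertificateRows (zhUnity_of_gaussCert)

variable {F : T4Family} {N : ℕ} [NeZero N]

variable (θ : Stage13HParams F N) (p : B12.RunParams)

/-! ## §1  The ZhPin class: a v1.7 parameter whose history-indexed residual has the certificate's `ζ0` (this seat's `rePinH θ`, dag-n11-w1's `gaussPinH θ`, …) -/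

/-- **★★★ 12a″'s READING-REGION LAW ON THE CUT SELECTOR, IN THE ZhPin CLASS, FROM [15]-SOLVABILITY AT EVERY LEVEL** — `…N11ReadRegRePinned.regOn_rePinH_cutSel_of_solvable`
transported along `hζ0` (the law reads the residual only through `ζ0`, and `rePinH θ` has the same Stage-13 part). [cite: Balaban1988Convergent, (2.2) p.255, (2.10) p.256, (2.16)–(2.17) p.257, (3.16) p.268, p.267; Balaban1985Variational, Thm 1 (7)–(8) pp.278–279; Balaban1985Averaging, Prop. 2 p.26] -/
theorem regOn_cutSel_of_zhPin_of_solvable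
    (hζ0 : ∀ (p' : B12.RunParams) (n : ℕ) (Ω Λ : ℕ → Set (Site (F.P p'.K) 0)), (θ.Zh p' n Ω Λ).ζ0 = (ZhPinOfRecord₁₃ θ.toStage13Params p' Ω Λ).ζ0)
    {k : ℕ} (hkK : k ≤ p.K) (hkm : k ≤ (F.P p.K).m + (F.P p.K).K) (hcR : 2 ≤ θ.s2.cR) (hM : 1 ≤ θ.ν.M₁)
    (h3 : ∀ j, 1 ≤ j → j ≤ k →
      3 * side (F.P p.K).L θ.ν.M₁ j ≤ cubeSide (F.P p.K).L θ.ν.M₂ (RkOfRecord (F.P p.K).L θ.ν.r (gOfRecord₁₃ F N θ.toStage13Params p j)) j)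
    (hR : ∀ j, 1 ≤ j → j ≤ k → (F.P p.K).L ^ j + (((F.P p.K).d + 4) * (F.P p.K).L + 2) * (∑ l ∈ Finset.range j, (F.P p.K).L ^ l) + 2 ≤
      cubeSide (F.P p.K).L θ.ν.M₂ (RkOfRecord (F.P p.K).L θ.ν.r (gOfRecord₁₃ F N θ.toStage13Params p j)) j)
    (hε : ∀ j, 1 ≤ j → j ≤ k → 0 < epsOfRecord θ.ν (gOfRecord₁₃ F N θ.toStage13Params p) j)
    (hε3 : ∀ j, 1 ≤ j → j ≤ k → (143 * (((((F.P p.K).d + 4 : ℕ) : ℝ)) ^ 2 / 4) ^ 2) * epsOfRecord θ.ν (gOfRecord₁₃ F N θ.toStage13Params p) j ≤ 1 / 3)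
    (hε2 : ∀ j, 1 ≤ j → j ≤ k →
      2 * epsOfRecord θ.ν (gOfRecord₁₃ F N θ.toStage13Params p) j ≤ 2 * ExpMeanLog.deltaSU (Fin N) / ((((F.P p.K).d + 4) * (F.P p.K).L : ℕ) : ℝ) ^ 2)
    (hsolv : ∀ j, 1 ≤ j → j ≤ k → ∀ (s : SeqOfRecord F θ.ν θ.τ9.M (gOfRecord₁₃ F N θ.toStage13Params p) p.K j) (V : GaugeField (F.P p.K) j (SU N)),
      chiSeqOfRecord F N θ.ν θ.τ9.M (gOfRecord₁₃ F N θ.toStage13Params p) p.K j s V ≠ 0 →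
      ∀ a ∈ cubesIn (fun a : ↥(cubeIndices (F.P p.K) (cubeSide (F.P p.K).L θ.ν.M₂ (RkOfRecord (F.P p.K).L θ.ν.r (gOfRecord₁₃ F N θ.toStage13Params p j)) j)) =>
          cubeEnl (F.P p.K) (cubeSide (F.P p.K).L θ.ν.M₂ (RkOfRecord (F.P p.K).L θ.ν.r (gOfRecord₁₃ F N θ.toStage13Params p j)) j) a 0) (s.Ω j),
        ∃ U₀, IsMinimizer (avOfRecord F N p.K) {U | PlaqSmall (θ.ν.εreg * (F.P p.K).eta j ^ 2) U}
          (Bj θ.ν.M₁ (cubeEnl (F.P p.K) (cubeSide (F.P p.K).L θ.ν.M₂ (RkOfRecord (F.P p.K).L θ.ν.r (gOfRecord₁₃ F N θ.toStage13Params p j)) j) a 4) j)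
          (avgFamily (avOfRecord F N p.K) (qsstarGIter0 j V)) U₀)
    (hcov : ∀ j, 1 ≤ j → j ≤ k → ∀ s : SeqOfRecord F θ.ν θ.τ9.M (gOfRecord₁₃ F N θ.toStage13Params p) p.K j,
      s.Ω j ⊆ ⋃ a ∈ cubesIn (fun a : ↥(cubeIndices (F.P p.K) (cubeSide (F.P p.K).L θ.ν.M₂ (RkOfRecord (F.P p.K).L θ.ν.r (gOfRecord₁₃ F N θ.toStage13Params p j)) j)) =>
          cubeEnl (F.P p.K) (cubeSide (F.P p.K).L θ.ν.M₂ (RkOfRecord (F.P p.K).L θ.ν.r (gOfRecord₁₃ F N θ.toStage13Params p j)) j) a 0) (s.Ω j),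
        cubeEnl (F.P p.K) (cubeSide (F.P p.K).L θ.ν.M₂ (RkOfRecord (F.P p.K).L θ.ν.r (gOfRecord₁₃ F N θ.toStage13Params p j)) j) a 0)
    (s₀ : SeqOfRecord F θ.ν θ.τ9.M (gOfRecord₁₃ F N θ.toStage13Params p) p.K k) :
    (θ.zhAt p s₀).RegOn F N (FluctV N) θ.ν θ.s2.cR p (gOfRecord₁₃ F N θ.toStage13Params p)
      (fun j Y => {x | (j < k ∧ Y = (s₀.Ω (j + 1))ᶜ) ∧ x ∈ readSelOfSeq F p (suppDomOfRecord F θ.ν p.K s₀.Ω) s₀.Ω j Y}) := by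
  intro j Y ω hne
  have hζ : (θ.zhAt p s₀).ζ0 j Y ω = ((rePinH θ).zhAt p s₀).ζ0 j Y ω := by
    show (θ.Zh p k s₀.Ω s₀.Λ).ζ0 j Y ω = _
    rw [hζ0 p k s₀.Ω s₀.Λ]
    rfl
  rw [hζ] at hne
  exact regOn_rePinH_cutSel_of_solvable θ p hkK hkm hcR hM h3 hR hε hε3 hε2 hsolv hcov s₀ j Y ω hne

/-! ## §2  ★★★★★ The no-expansion 𝐓-step in the ZhPin class from K0's rows and the structural rows alone -/

/-- **★★★★★ THE NO-EXPANSION 𝐓-STEP IN THE ZhPin CLASS FROM K0's ROWS AND THE STRUCTURAL ROWS ALONE — `ZhUnity`, `RegOn` AND `h7` ALL DISCHARGED** (SLaw-keyed).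
As p598649's SLaw face ∕ g13's `…OfSolvableFibre` (conclusion VERBATIM, θ GENERIC in the ZhPin class `hζ0`): from the record rows (`Provisos₁₃SepCoPH`, `Admissible`, `s2.Pos`,
window, `PartCompat₁₃`, `0 < M₁ ≤ M`, `1 ≤ M`), the numerics (`2 ≤ cR`, `ε_j` in [B7] Prop. 2's range, cube side vs boxes, `1 ≤ k ≤ m + K`), and K0's per-cube [15]-SOLVABILITY
inside `χ_j` plus the cube cover AT EVERY LEVEL `1 ≤ j ≤ k`, the no-expansion 𝐓-step holds for `SLaw₁₃CoPH F N θ p k`.  Instances: `rePinH θ′` (`hζ0 := rePinH_zhPin θ′`, §3),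
dag-n11-w1's `gaussPinH θ′` (`hζ0 := gaussPinH_ζ0 θ′`).
[cite: Balaban1988Convergent, Theorem p.245, Thm 1 p.262, (2.1)–(2.2) pp.254–255, (2.7) p.255, (2.10) p.256, (2.16)–(2.18) p.257, (2.20)–(2.28) pp.258–259, (3.5) p.265, (3.16) p.268, (3.24)–(3.25) p.270; Balaban1985Variational, Thm 1 (7)–(8) pp.278–279; Balaban1985Averaging, Prop. 2 p.26; Balaban1985RegularSpaces, (1.3)–(1.6) p.77] -/
theorem exists_local_witness_clause_succ_of_sLaw₁₃CoPH_of_zhPin_of_solvable (hζ0 : ∀ (p' : B12.RunParams) (n : ℕ) (Ω Λ : ℕ → Set (Site (F.P p'.K) 0)), (θ.Zh p' n Ω Λ).ζ0 = (ZhPinOfRecord₁₃ θ.toStage13Params p' Ω Λ).ζ0)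
    (h : θ.Provisos₁₃SepCoPH F N) (hθ : θ.Admissible F N)
    (hpos : θ.s2.Pos) (hM₁ : 0 < θ.ν.M₁) (hle : θ.ν.M₁ ≤ θ.τ9.M) {k : ℕ} (hk : k < p.K) (hM : 1 ≤ θ.τ9.M)
    (hw : Step.InInterval θ.γ k (gOfRecord₁₃ F N θ.toStage13Params p)) (hPC : PartCompat₁₃ F N θ.toStage13Params p k)
    (hk1 : 1 ≤ k) (hkm : k ≤ (F.P p.K).m + (F.P p.K).K) (hcR : 2 ≤ θ.s2.cR)
    (h3 : ∀ j, 1 ≤ j → j ≤ k →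
      3 * side (F.P p.K).L θ.ν.M₁ j ≤ cubeSide (F.P p.K).L θ.ν.M₂ (RkOfRecord (F.P p.K).L θ.ν.r (gOfRecord₁₃ F N θ.toStage13Params p j)) j)
    (hR : ∀ j, 1 ≤ j → j ≤ k → (F.P p.K).L ^ j + (((F.P p.K).d + 4) * (F.P p.K).L + 2) * (∑ l ∈ Finset.range j, (F.P p.K).L ^ l) + 2 ≤
      cubeSide (F.P p.K).L θ.ν.M₂ (RkOfRecord (F.P p.K).L θ.ν.r (gOfRecord₁₃ F N θ.toStage13Params p j)) j)
    (hε : ∀ j, 1 ≤ j → j ≤ k → 0 < epsOfRecord θ.ν (gOfRecord₁₃ F N θ.toStage13Params p) j)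
    (hε3 : ∀ j, 1 ≤ j → j ≤ k → (143 * (((((F.P p.K).d + 4 : ℕ) : ℝ)) ^ 2 / 4) ^ 2) * epsOfRecord θ.ν (gOfRecord₁₃ F N θ.toStage13Params p) j ≤ 1 / 3)
    (hε2 : ∀ j, 1 ≤ j → j ≤ k →
      2 * epsOfRecord θ.ν (gOfRecord₁₃ F N θ.toStage13Params p) j ≤ 2 * ExpMeanLog.deltaSU (Fin N) / ((((F.P p.K).d + 4) * (F.P p.K).L : ℕ) : ℝ) ^ 2)
    (hsolv : ∀ j, 1 ≤ j → j ≤ k → ∀ (s : SeqOfRecord F θ.ν θ.τ9.M (gOfRecord₁₃ F N θ.toStage13Params p) p.K j) (V : GaugeField (F.P p.K) j (SU N)),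
      chiSeqOfRecord F N θ.ν θ.τ9.M (gOfRecord₁₃ F N θ.toStage13Params p) p.K j s V ≠ 0 →
      ∀ a ∈ cubesIn (fun a : ↥(cubeIndices (F.P p.K) (cubeSide (F.P p.K).L θ.ν.M₂ (RkOfRecord (F.P p.K).L θ.ν.r (gOfRecord₁₃ F N θ.toStage13Params p j)) j)) =>
          cubeEnl (F.P p.K) (cubeSide (F.P p.K).L θ.ν.M₂ (RkOfRecord (F.P p.K).L θ.ν.r (gOfRecord₁₃ F N θ.toStage13Params p j)) j) a 0) (s.Ω j),
        ∃ U₀, IsMinimizer (avOfRecord F N p.K) {U | PlaqSmall (θ.ν.εreg * (F.P p.K).eta j ^ 2) U}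
          (Bj θ.ν.M₁ (cubeEnl (F.P p.K) (cubeSide (F.P p.K).L θ.ν.M₂ (RkOfRecord (F.P p.K).L θ.ν.r (gOfRecord₁₃ F N θ.toStage13Params p j)) j) a 4) j)
          (avgFamily (avOfRecord F N p.K) (qsstarGIter0 j V)) U₀)
    (hcov : ∀ j, 1 ≤ j → j ≤ k → ∀ s : SeqOfRecord F θ.ν θ.τ9.M (gOfRecord₁₃ F N θ.toStage13Params p) p.K j,
      s.Ω j ⊆ ⋃ a ∈ cubesIn (fun a : ↥(cubeIndices (F.P p.K) (cubeSide (F.P p.K).L θ.ν.M₂ (RkOfRecord (F.P p.K).L θ.ν.r (gOfRecord₁₃ F N θ.toStage13Params p j)) j)) =>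
          cubeEnl (F.P p.K) (cubeSide (F.P p.K).L θ.ν.M₂ (RkOfRecord (F.P p.K).L θ.ν.r (gOfRecord₁₃ F N θ.toStage13Params p j)) j) a 0) (s.Ω j),
        cubeEnl (F.P p.K) (cubeSide (F.P p.K).L θ.ν.M₂ (RkOfRecord (F.P p.K).L θ.ν.r (gOfRecord₁₃ F N θ.toStage13Params p j)) j) a 0)
    (hS : SLaw₁₃CoPH F N θ p k) :
    ∃ (t : SeqOfRecord F θ.ν θ.τ9.M (gOfRecord₁₃ F N θ.toStage13Params p) p.K k → Sect2.TermValues (F.P p.K) (MatA N) (FluctV N) θ.τ9.M)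
      (Ek : SeqOfRecord F θ.ν θ.τ9.M (gOfRecord₁₃ F N θ.toStage13Params p) p.K k → ℝ),
      HasSect2FormAtZS F N (FluctV N) p.K (settingOfRecord₁₃ F N θ.toStage13Params p) k (θ.rzAt p) (WtOfRecord₁₃H F N θ p)
          (UbgOfRecord₁₃CoP F N θ.toStage13Params p k)
          (fun s₀ t₀ => Sect2.LawsRT (sect2TowerOfRecord F N (FluctV N) p.K (settingOfRecord₁₃ F N θ.toStage13Params p) (θ.rzAt p s₀) s₀ t₀)
            (settingOfRecord₁₃ F N θ.toStage13Params p).lf k)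
          (slotsOfRecord F N θ.ν θ.τ9 (EOfRecord₁₃ F N θ.toStage13Params) (wOfRecord₉ F N θ.toStage9Params) θ.ppSel p
            (gOfRecord₁₃ F N θ.toStage13Params p) k) t Ek ∧
      (∀ s₀, IsFluctLocal k (t s₀)) ∧
      ∀ (s : SeqOfRecord F θ.ν θ.τ9.M (gOfRecord₁₃ F N θ.toStage13Params p) p.K (k + 1)), s.Ω (k + 1) = ∅ →
        -- (P) prefix agreement below `k`
        (∀ j, j < k → (θ.zhAt p s).ζ0 j = (θ.zhAt p s.init).ζ0 j ∧ (θ.zhAt p s).quad j = (θ.zhAt p s.init).quad j) →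
        -- (V) the generation-`k` pin with the old front factor
        (∀ (V' : GaugeField (F.P p.K) (k + 1) (SU N)) (U₀ : GaugeField (F.P p.K) k (SU N)),
          (θ.zhAt p s).ζ0 k Set.univ (pairCfgAt (V := FluctV N) k V' U₀) =
            chiSeqOfRecord F N θ.ν θ.τ9.M (gOfRecord₁₃ F N θ.toStage13Params p) p.K k s.init U₀ *
              wOfRecord₉ F N θ.toStage9Params p (gOfRecord₁₃ F N θ.toStage13Params p) k s U₀ ((avOfRecord F N p.K k).avg U₀)) →
        -- `quad_k(∅) = 0` on the two-scale configurations
        (∀ (V' : GaugeField (F.P p.K) (k + 1) (SU N)) (U₀ : GaugeField (F.P p.K) k (SU N)), (θ.zhAt p s).quad k ∅ (pairCfgAt (V := FluctV N) k V' U₀) = 0) →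
        -- `k`-locality of `quad_j(Λ_{j+1})`, `j < k`
        (∀ j, j < k → ∀ ω ω' : MultiCfg (F.P p.K) (SU N) (FluctV N), (∀ i, i ≤ k → ω i = ω' i) →
          (θ.zhAt p s).quad j (s.init.Λ (j + 1)) ω = (θ.zhAt p s).quad j (s.init.Λ (j + 1)) ω') →
        -- measurability of the residual serving `s′`
        (∀ j (Y : Set (Site (F.P p.K) 0)), Measurable ((θ.zhAt p s).ζ0 j Y)) →
        (∀ j (Λ' : Set (Site (F.P p.K) 0)), Measurable ((θ.zhAt p s).quad j Λ')) →
        -- per old branch: A-fibre domination (K0b)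
        (∀ S ∈ admSOfRecord F θ.ν θ.τ9.M (gOfRecord₁₃ F N θ.toStage13Params p) p.K k s.init, ∀ j : ℕ,
          ∃ ŵ : (↥(Set.toFinite (B10Eq42TorusConstraint.bondsIn j ((s.init.Λ (j + 1))ᶜ ∩ s.init.Ω (j + 1)))).toFinset → FluctV N) → ℝ≥0∞, Measurable ŵ ∧
            (∫⁻ a, ŵ a ∂(Measure.pi fun _ : ↥(Set.toFinite (B10Eq42TorusConstraint.bondsIn j ((s.init.Λ (j + 1))ᶜ ∩ s.init.Ω (j + 1)))).toFinset => (volume : Measure (FluctV N)))) ≠ ⊤ ∧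
            ∀ ω, ENNReal.ofReal ((WtOfRecord₁₃H F N θ p s).w j (s.init.Λ (j + 1)) ((s.init.Λ (j + 1))ᶜ ∩ s.init.Ω (j + 1)) (S (j + 1)) ω) ≤
              ŵ (fun b : ↥(Set.toFinite (B10Eq42TorusConstraint.bondsIn j ((s.init.Λ (j + 1))ᶜ ∩ s.init.Ω (j + 1)))).toFinset => (ω j).2 b)) →
        -- def-T: the 𝐁-terms of the witness at the parent history, READ AT THE EMBEDDED BACKGROUND, are JOINTLY measurable in `(U, A)` (LOCATED residue)
        (∀ (S' : ℕ → Set (Site (F.P p.K) 0)) (j : ℕ) (X : (Sect2.domSys (F.P p.K) θ.τ9.M j).Dom),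
          Measurable (fun q : GaugeField (F.P p.K) 0 (SU N) × MSFluct (F.P p.K) (FluctV N) =>
            ((t s.init).B j X (Sect2.ofBackgroundC (settingOfRecord₁₃ F N θ.toStage13Params p).ι q.1) (S', q.2)).re)) →
        (slotsTOfRecord F N θ.ν θ.τ9 (EOfRecord₁₃ F N θ.toStage13Params) (wOfRecord₉ F N θ.toStage9Params) θ.ppSel p
            (gOfRecord₁₃ F N θ.toStage13Params p) (k + 1) s = 0 ∨
          ∀ᵐ V' ∂fieldMeasure (F.P p.K) (k + 1) (SU N),
            chiSeqOfRecord F N θ.ν θ.τ9.M (gOfRecord₁₃ F N θ.toStage13Params p) p.K (k + 1) s V' ≠ 0 →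
              slotsTOfRecord F N θ.ν θ.τ9 (EOfRecord₁₃ F N θ.toStage13Params) (wOfRecord₉ F N θ.toStage9Params) θ.ppSel p
                  (gOfRecord₁₃ F N θ.toStage13Params p) (k + 1) s V' =
                sect2Slot F N (FluctV N) p.K (settingOfRecord₁₃ F N θ.toStage13Params p) (θ.rzAt p s) (WtOfRecord₁₃H F N θ p s) s
                  (t s.init) (Ek s.init) (UbgOfRecord₁₃CoP F N θ.toStage13Params p (k + 1) s) V') :=
  exists_local_witness_clause_succ_of_sLaw₁₃CoPH_of_sep_of_junctionFibre θ p h (zhUnity_of_gaussCert θ hζ0) hθ hpos hM₁ hle hk hM hw hPC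
    θ.s2.cR (fun s₀ j Y => {x | (j < k ∧ Y = (s₀.Ω (j + 1))ᶜ) ∧ x ∈ readSelOfSeq F p (suppDomOfRecord F θ.ν p.K s₀.Ω) s₀.Ω j Y})
    (fun s₀ => regOn_cutSel_of_zhPin_of_solvable θ p hζ0 hk.le hkm hcR hM₁ h3 hR hε hε3 hε2 hsolv hcov s₀)
    (fun s₀ hch hs Wc hχ hlow => sepJunctionChargedFibre_of_solvable θ p hk1 hkm hcR hM₁ (h3 k hk1 le_rfl) (hR k hk1 le_rfl) (hε k hk1 le_rfl)
      (hε3 k hk1 le_rfl) (hε2 k hk1 le_rfl) (fun s₁ _ _ Wc₁ hχ₁ => hsolv k hk1 le_rfl s₁ (Wc₁ k) hχ₁) (fun s₁ => hcov k hk1 le_rfl s₁) s₀ hch hs Wc hχ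
      fun j hj => by have h' := hlow j hj; beta_reduce at h'; rw [sep_setOf_eq_of (And.intro hj rfl)] at h'; exact h')
    hS

/-- **★★★★★ THE WITNESS-FIRST NO-EXPANSION 𝐓-STEP IN THE ZhPin CLASS FROM K0's ROWS AND THE STRUCTURAL ROWS ALONE — `ZhUnity`, `RegOn` AND `h7` ALL DISCHARGED**
(a NAMED §2 witness `(t₀, E₀)` with Borel 𝐁-terms `hBt`; conclusion VERBATIM p598649's witness-first face, θ GENERIC in the ZhPin class).
[cite: Balaban1988Convergent, Theorem p.245, Thm 1 p.262, (2.1)–(2.2) pp.254–255, (2.7) p.255, (2.10) p.256, (2.16)–(2.18) p.257, (2.20)–(2.28) pp.258–259, (3.5) p.265, (3.16) p.268, (3.24)–(3.25) p.270; Balaban1985Variational, Thm 1 (7)–(8) pp.278–279; Balaban1985Averaging, Prop. 2 p.26; Balaban1985RegularSpaces, (1.3)–(1.6) p.77; Balaban1987RG1, Thm 3 p.264] -/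
theorem exists_local_witness_clause_succ_of_hasSect2FormAtZS_of_borelB_of_zhPin_of_solvable (hζ0 : ∀ (p' : B12.RunParams) (n : ℕ) (Ω Λ : ℕ → Set (Site (F.P p'.K) 0)), (θ.Zh p' n Ω Λ).ζ0 = (ZhPinOfRecord₁₃ θ.toStage13Params p' Ω Λ).ζ0)
    (h : θ.Provisos₁₃SepCoPH F N) (hθ : θ.Admissible F N)
    (hpos : θ.s2.Pos) (hM₁ : 0 < θ.ν.M₁) (hle : θ.ν.M₁ ≤ θ.τ9.M) {k : ℕ} (hk : k < p.K) (hM : 1 ≤ θ.τ9.M)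
    (hw : Step.InInterval θ.γ k (gOfRecord₁₃ F N θ.toStage13Params p)) (hPC : PartCompat₁₃ F N θ.toStage13Params p k)
    (hk1 : 1 ≤ k) (hkm : k ≤ (F.P p.K).m + (F.P p.K).K) (hcR : 2 ≤ θ.s2.cR)
    (h3 : ∀ j, 1 ≤ j → j ≤ k →
      3 * side (F.P p.K).L θ.ν.M₁ j ≤ cubeSide (F.P p.K).L θ.ν.M₂ (RkOfRecord (F.P p.K).L θ.ν.r (gOfRecord₁₃ F N θ.toStage13Params p j)) j)
    (hR : ∀ j, 1 ≤ j → j ≤ k → (F.P p.K).L ^ j + (((F.P p.K).d + 4) * (F.P p.K).L + 2) * (∑ l ∈ Finset.range j, (F.P p.K).L ^ l) + 2 ≤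
      cubeSide (F.P p.K).L θ.ν.M₂ (RkOfRecord (F.P p.K).L θ.ν.r (gOfRecord₁₃ F N θ.toStage13Params p j)) j)
    (hε : ∀ j, 1 ≤ j → j ≤ k → 0 < epsOfRecord θ.ν (gOfRecord₁₃ F N θ.toStage13Params p) j)
    (hε3 : ∀ j, 1 ≤ j → j ≤ k → (143 * (((((F.P p.K).d + 4 : ℕ) : ℝ)) ^ 2 / 4) ^ 2) * epsOfRecord θ.ν (gOfRecord₁₃ F N θ.toStage13Params p) j ≤ 1 / 3)
    (hε2 : ∀ j, 1 ≤ j → j ≤ k →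
      2 * epsOfRecord θ.ν (gOfRecord₁₃ F N θ.toStage13Params p) j ≤ 2 * ExpMeanLog.deltaSU (Fin N) / ((((F.P p.K).d + 4) * (F.P p.K).L : ℕ) : ℝ) ^ 2)
    (hsolv : ∀ j, 1 ≤ j → j ≤ k → ∀ (s : SeqOfRecord F θ.ν θ.τ9.M (gOfRecord₁₃ F N θ.toStage13Params p) p.K j) (V : GaugeField (F.P p.K) j (SU N)),
      chiSeqOfRecord F N θ.ν θ.τ9.M (gOfRecord₁₃ F N θ.toStage13Params p) p.K j s V ≠ 0 →
      ∀ a ∈ cubesIn (fun a : ↥(cubeIndices (F.P p.K) (cubeSide (F.P p.K).L θ.ν.M₂ (RkOfRecord (F.P p.K).L θ.ν.r (gOfRecord₁₃ F N θ.toStage13Params p j)) j)) =>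
          cubeEnl (F.P p.K) (cubeSide (F.P p.K).L θ.ν.M₂ (RkOfRecord (F.P p.K).L θ.ν.r (gOfRecord₁₃ F N θ.toStage13Params p j)) j) a 0) (s.Ω j),
        ∃ U₀, IsMinimizer (avOfRecord F N p.K) {U | PlaqSmall (θ.ν.εreg * (F.P p.K).eta j ^ 2) U}
          (Bj θ.ν.M₁ (cubeEnl (F.P p.K) (cubeSide (F.P p.K).L θ.ν.M₂ (RkOfRecord (F.P p.K).L θ.ν.r (gOfRecord₁₃ F N θ.toStage13Params p j)) j) a 4) j)
          (avgFamily (avOfRecord F N p.K) (qsstarGIter0 j V)) U₀)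
    (hcov : ∀ j, 1 ≤ j → j ≤ k → ∀ s : SeqOfRecord F θ.ν θ.τ9.M (gOfRecord₁₃ F N θ.toStage13Params p) p.K j,
      s.Ω j ⊆ ⋃ a ∈ cubesIn (fun a : ↥(cubeIndices (F.P p.K) (cubeSide (F.P p.K).L θ.ν.M₂ (RkOfRecord (F.P p.K).L θ.ν.r (gOfRecord₁₃ F N θ.toStage13Params p j)) j)) =>
          cubeEnl (F.P p.K) (cubeSide (F.P p.K).L θ.ν.M₂ (RkOfRecord (F.P p.K).L θ.ν.r (gOfRecord₁₃ F N θ.toStage13Params p j)) j) a 0) (s.Ω j),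
        cubeEnl (F.P p.K) (cubeSide (F.P p.K).L θ.ν.M₂ (RkOfRecord (F.P p.K).L θ.ν.r (gOfRecord₁₃ F N θ.toStage13Params p j)) j) a 0)
    (t₀ : SeqOfRecord F θ.ν θ.τ9.M (gOfRecord₁₃ F N θ.toStage13Params p) p.K k → Sect2.TermValues (F.P p.K) (MatA N) (FluctV N) θ.τ9.M)
    (E₀ : SeqOfRecord F θ.ν θ.τ9.M (gOfRecord₁₃ F N θ.toStage13Params p) p.K k → ℝ)
    (hform₀ : HasSect2FormAtZS F N (FluctV N) p.K (settingOfRecord₁₃ F N θ.toStage13Params p) k (θ.rzAt p) (WtOfRecord₁₃H F N θ p)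
      (UbgOfRecord₁₃CoP F N θ.toStage13Params p k)
      (fun s₀ t' => Sect2.LawsRT (sect2TowerOfRecord F N (FluctV N) p.K (settingOfRecord₁₃ F N θ.toStage13Params p) (θ.rzAt p s₀) s₀ t')
        (settingOfRecord₁₃ F N θ.toStage13Params p).lf k)
      (slotsOfRecord F N θ.ν θ.τ9 (EOfRecord₁₃ F N θ.toStage13Params) (wOfRecord₉ F N θ.toStage9Params) θ.ppSel p (gOfRecord₁₃ F N θ.toStage13Params p) k) t₀ E₀)
    (hBt : ∀ s₀ (S' : ℕ → Set (Site (F.P p.K) 0)) (j : ℕ) (X : (Sect2.domSys (F.P p.K) θ.τ9.M j).Dom),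
      Measurable (fun q : GaugeField (F.P p.K) 0 (SU N) × MSFluct (F.P p.K) (FluctV N) =>
        (t₀ s₀).B j X (Sect2.ofBackgroundC (settingOfRecord₁₃ F N θ.toStage13Params p).ι q.1) (S', q.2))) :
    ∃ (t : SeqOfRecord F θ.ν θ.τ9.M (gOfRecord₁₃ F N θ.toStage13Params p) p.K k → Sect2.TermValues (F.P p.K) (MatA N) (FluctV N) θ.τ9.M)
      (Ek : SeqOfRecord F θ.ν θ.τ9.M (gOfRecord₁₃ F N θ.toStage13Params p) p.K k → ℝ),
      HasSect2FormAtZS F N (FluctV N) p.K (settingOfRecord₁₃ F N θ.toStage13Params p) k (θ.rzAt p) (WtOfRecord₁₃H F N θ p)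
          (UbgOfRecord₁₃CoP F N θ.toStage13Params p k)
          (fun s₀ t₀ => Sect2.LawsRT (sect2TowerOfRecord F N (FluctV N) p.K (settingOfRecord₁₃ F N θ.toStage13Params p) (θ.rzAt p s₀) s₀ t₀)
            (settingOfRecord₁₃ F N θ.toStage13Params p).lf k)
          (slotsOfRecord F N θ.ν θ.τ9 (EOfRecord₁₃ F N θ.toStage13Params) (wOfRecord₉ F N θ.toStage9Params) θ.ppSel p
            (gOfRecord₁₃ F N θ.toStage13Params p) k) t Ek ∧
      (∀ s₀, IsFluctLocal k (t s₀)) ∧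
      ∀ (s : SeqOfRecord F θ.ν θ.τ9.M (gOfRecord₁₃ F N θ.toStage13Params p) p.K (k + 1)), s.Ω (k + 1) = ∅ →
        -- (P) prefix agreement below `k`
        (∀ j, j < k → (θ.zhAt p s).ζ0 j = (θ.zhAt p s.init).ζ0 j ∧ (θ.zhAt p s).quad j = (θ.zhAt p s.init).quad j) →
        -- (V) the generation-`k` pin with the old front factor
        (∀ (V' : GaugeField (F.P p.K) (k + 1) (SU N)) (U₀ : GaugeField (F.P p.K) k (SU N)),
          (θ.zhAt p s).ζ0 k Set.univ (pairCfgAt (V := FluctV N) k V' U₀) =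
            chiSeqOfRecord F N θ.ν θ.τ9.M (gOfRecord₁₃ F N θ.toStage13Params p) p.K k s.init U₀ *
              wOfRecord₉ F N θ.toStage9Params p (gOfRecord₁₃ F N θ.toStage13Params p) k s U₀ ((avOfRecord F N p.K k).avg U₀)) →
        -- `quad_k(∅) = 0` on the two-scale configurations
        (∀ (V' : GaugeField (F.P p.K) (k + 1) (SU N)) (U₀ : GaugeField (F.P p.K) k (SU N)), (θ.zhAt p s).quad k ∅ (pairCfgAt (V := FluctV N) k V' U₀) = 0) →
        -- `k`-locality of `quad_j(Λ_{j+1})`, `j < k`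
        (∀ j, j < k → ∀ ω ω' : MultiCfg (F.P p.K) (SU N) (FluctV N), (∀ i, i ≤ k → ω i = ω' i) →
          (θ.zhAt p s).quad j (s.init.Λ (j + 1)) ω = (θ.zhAt p s).quad j (s.init.Λ (j + 1)) ω') →
        -- measurability of the residual serving `s′`
        (∀ j (Y : Set (Site (F.P p.K) 0)), Measurable ((θ.zhAt p s).ζ0 j Y)) →
        (∀ j (Λ' : Set (Site (F.P p.K) 0)), Measurable ((θ.zhAt p s).quad j Λ')) →
        -- per old branch: A-fibre domination (K0b)
        (∀ S ∈ admSOfRecord F θ.ν θ.τ9.M (gOfRecord₁₃ F N θ.toStage13Params p) p.K k s.init, ∀ j : ℕ,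
          ∃ ŵ : (↥(Set.toFinite (B10Eq42TorusConstraint.bondsIn j ((s.init.Λ (j + 1))ᶜ ∩ s.init.Ω (j + 1)))).toFinset → FluctV N) → ℝ≥0∞, Measurable ŵ ∧
            (∫⁻ a, ŵ a ∂(Measure.pi fun _ : ↥(Set.toFinite (B10Eq42TorusConstraint.bondsIn j ((s.init.Λ (j + 1))ᶜ ∩ s.init.Ω (j + 1)))).toFinset => (volume : Measure (FluctV N)))) ≠ ⊤ ∧
            ∀ ω, ENNReal.ofReal ((WtOfRecord₁₃H F N θ p s).w j (s.init.Λ (j + 1)) ((s.init.Λ (j + 1))ᶜ ∩ s.init.Ω (j + 1)) (S (j + 1)) ω) ≤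
              ŵ (fun b : ↥(Set.toFinite (B10Eq42TorusConstraint.bondsIn j ((s.init.Λ (j + 1))ᶜ ∩ s.init.Ω (j + 1)))).toFinset => (ω j).2 b)) →
        (slotsTOfRecord F N θ.ν θ.τ9 (EOfRecord₁₃ F N θ.toStage13Params) (wOfRecord₉ F N θ.toStage9Params) θ.ppSel p
            (gOfRecord₁₃ F N θ.toStage13Params p) (k + 1) s = 0 ∨
          ∀ᵐ V' ∂fieldMeasure (F.P p.K) (k + 1) (SU N),
            chiSeqOfRecord F N θ.ν θ.τ9.M (gOfRecord₁₃ F N θ.toStage13Params p) p.K (k + 1) s V' ≠ 0 →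
              slotsTOfRecord F N θ.ν θ.τ9 (EOfRecord₁₃ F N θ.toStage13Params) (wOfRecord₉ F N θ.toStage9Params) θ.ppSel p
                  (gOfRecord₁₃ F N θ.toStage13Params p) (k + 1) s V' =
                sect2Slot F N (FluctV N) p.K (settingOfRecord₁₃ F N θ.toStage13Params p) (θ.rzAt p s) (WtOfRecord₁₃H F N θ p s) s
                  (t s.init) (Ek s.init) (UbgOfRecord₁₃CoP F N θ.toStage13Params p (k + 1) s) V') :=
  exists_local_witness_clause_succ_of_hasSect2FormAtZS_of_borelB_of_sep_of_junctionFibre θ p h (zhUnity_of_gaussCert θ hζ0) hθ hpos hM₁ hle hk hM hw hPC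
    θ.s2.cR (fun s₀ j Y => {x | (j < k ∧ Y = (s₀.Ω (j + 1))ᶜ) ∧ x ∈ readSelOfSeq F p (suppDomOfRecord F θ.ν p.K s₀.Ω) s₀.Ω j Y})
    (fun s₀ => regOn_cutSel_of_zhPin_of_solvable θ p hζ0 hk.le hkm hcR hM₁ h3 hR hε hε3 hε2 hsolv hcov s₀)
    (fun s₀ hch hs Wc hχ hlow => sepJunctionChargedFibre_of_solvable θ p hk1 hkm hcR hM₁ (h3 k hk1 le_rfl) (hR k hk1 le_rfl) (hε k hk1 le_rfl)
      (hε3 k hk1 le_rfl) (hε2 k hk1 le_rfl) (fun s₁ _ _ Wc₁ hχ₁ => hsolv k hk1 le_rfl s₁ (Wc₁ k) hχ₁) (fun s₁ => hcov k hk1 le_rfl s₁) s₀ hch hs Wc hχ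
      fun j hj => by have h' := hlow j hj; beta_reduce at h'; rw [sep_setOf_eq_of (And.intro hj rfl)] at h'; exact h')
    t₀ E₀ hform₀ hBt

/-! ## §3  At this seat's A6 inhabitant `rePinH θ` (an instance of the class by `rfl`; dag-n11-w1's `gaussPinH θ` is another, by `gaussPinH_ζ0`) -/

/-- `rePinH θ` is in the ZhPin class (`rfl`) — so §2 applies at `rePinH θ` with the record rows transferred from `θ` by g9's `provisos₁₃SepCoPH_rePinH`,
`admissible_rePinH_iff`. [cite: Balaban1988Convergent, (3.16) p.268 (bookkeeping)] -/
theorem rePinH_zhPin : ∀ (p' : B12.RunParams) (n : ℕ) (Ω Λ : ℕ → Set (Site (F.P p'.K) 0)),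
    ((rePinH θ).Zh p' n Ω Λ).ζ0 = (ZhPinOfRecord₁₃ (rePinH θ).toStage13Params p' Ω Λ).ζ0 := fun _ _ _ _ => rfl

end Summit.QuantumFields.YangMills.Theorems.BalabanUVNodesN11NoExpansionTStepZhPinOfSolvable

end
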